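import Summits.QuantumFields.YangMills.Theorems.AlphaInputsT3ACv3StepTrivPinsBlockAvgKnit
import Summits.QuantumFields.YangMills.Theorems.AlphaInputsT3ACMinimiserPinConsts
import Summits.QuantumFields.YangMills.Theorems.UnitScaleTiltBlockAvgCorrector
import HarnessLib

/-!
# `AlphaInputsT3ACv3StepTrivPinsBlockAvgKnitWindow` — THE SIZE LINE OF THE RECORD KNIT ON A COUPLING WINDOW (∕ from ONE `γ₀`-row), and the canonical chart radius
# `ε_P := (10·|Idx P|)⁻¹` at the T³ record (cell ym3-torus; desk pub/ym-inputs INPUT-LIST v10 §3 I-10 ∕ I-12; sequel of seat p08 g3's F2c ∕ F2e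
# `AlphaInputsT3ACBlockAvgEMLWeightedFibreChart` ∕ `AlphaInputsT3ACv3StepTrivPinsBlockAvgKnit`; seat ym-inputs-p08 g4; helper `--supports stmt-QuantumFields-20520`)

WHAT.  The record knit (`PinnedStepTrivPins.fibre55WinAC_triv_of_blockAvgChart` ∕ `fibre57LowOnAC_of_blockAvgChart`) proves both trivial-history
fibre rows for the block averaging with the printed average MODULO print's (55) pins, the displayed data rows, and ONE size line
`0 ≤ ε₁(k)`, `((d+2)L)²ε₁(k)/4 < ε` at a chart radius `0 ≤ ε ≤ 1/10`, `10ε ≤ |Idx P|⁻¹`, `ε ≤ δ_N` (F2c's `exists_weightedFibreChart_global`).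
At the T³ record (`S := T3Scales F γ … K`, `𝔎 := 𝔠.lane`, `SU(2)`, `d = 3`) this size line is threshold arithmetic, and this file discharges it:
* §1 the CANONICAL RADIUS `ε_P := (10·|Idx P|)⁻¹` (`= emlWeight P/10`): `|Idx (F.P K)| = 36L³` (`BlockAvgCorrector.card_idx_T3`), so `ε_P = (360L³)⁻¹`, `0 ≤ ε_P ≤ 1/10`,
  `10ε_P = |Idx P|⁻¹`, `ε_P ≤ δ₂` (`eps_le_delta_two`) ⇒ `exists_weightedFibreChart_global_T3`: F2c's chart `(Φ, J, S)` at the record with NO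
  `ε`-hypothesis left (only `k + 1 ≤ m + K`);
* §2 the SIZE LINE on a COUPLING WINDOW: `ε₁(k) = θBal L γ b₀ p₀ (K − k)` at the T³ scales of any `0 < γ ≤ 1` (`eps1Of_T3Scales_eq_of_le_one`,
  the window-free form of `AlphaInputsT3AC.eps1Of_T3Scales_eq`) and `θBal ≤ σ` at every distance once `γ ≤ ((σ/(b₀Q₀(p₀)))²)²`
  (`T3Thresholds.θBal_le_of_le_gamma`), so — GENERIC in the target — `eps1Of_T3_mul_lt_of_le_gamma`: `γ ≤ (((ε/(2B))/(b₀Q₀))²)² ⟹ 0 < ε₁(k) ∧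
  B·ε₁(k) < ε` at every `(K, k ≤ K)` (the currency of the crux's prefix «`∃ γ₁, ∀ γ ≤ γ₁`», stmt 20520), and on the record's window
  `γ ≤ (min γ₀ 1)²` the same from ONE `γ₀`-row (`eps1Of_T3_mul_lt_of_gamma0`, via `MinimiserPin.le_gamma0_of_window`; the currency of the record rows of
  `AlphaInputsT3ACv4SeamWindow`); at today's numbers `B = (5L)²/4`, `ε = ε_P = (360L³)⁻¹`, threshold `(((4500·L⁵)⁻¹/(b₀Q₀(p₀)))²)²`:
  `sizeLine_T3_of_le_gamma` ∕ `sizeLine_T3_of_gamma0`;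
* §3 the two F2e rows AT THE RECORD with `hεS`∕`hwin` REPLACED by the size window on `γ` and `ε := ε_P` (`fibre55WinAC_triv_T3_of_le_gamma`,
  `fibre57LowOnAC_T3_of_le_gamma`): the I-10 ∕ I-12 trivial-history members now read «(55) PINS of `𝔖` (B0's definer) + displayed data rows» on the
  coupling window `γ ≤ min(1, (((4500·L⁵)⁻¹/(b₀Q₀(p₀)))²)²)` — equivalently, on the record's window, «… + ONE `γ₀`-row» (`γ₀ = min(γ₂₈, γ₄₆, γ_OO, γ₇₁)`
  is the record's DERIVED threshold; that row is a CONDITION on the record, displayed, not discharged here).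

HONEST SCOPE.  [folklore] bookkeeping of landed theorems; nothing of [Balaban1985UV3] asserted; NO pin, NO (O″χ) row at free data, NO `k = 0`
un-gating (★alpha-2 g8's verdict stands); count-neutral; no summit ∕ sub-problem statement proved (rung R3 bookkeeping — YM₃ on T³, RECORD; not T⁴,
not Clay; the Yang–Mills mass gap is NOT proved).  Def-free; L-floor: none (`1 < L` of the family only).
References: T. Bałaban, CMP 102 (1985) 255–275 [Balaban1985UV3] ((3) p.256, (7) p.257, (13)–(18) pp.259–260, (49)–(58) pp.268–270);
CMP 109 (1987) 249–301 [Balaban1987RG1] ((0.4) p.253).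
-/

set_option autoImplicit false

noncomputable section

namespace Summit.QuantumFields.YangMills.Theorems.PinnedStepTrivPins

open MeasureTheory Literature.MathematicalPhysics.QuantumFieldTheory.Balaban1983to89
open Literature.MathematicalPhysics.QuantumFieldTheory.Balaban1983to89.GaugeField (GaugeInvariant gaugeAct)
open Literature.MathematicalPhysics.QuantumFieldTheory.Balaban1983to89.BlockAveraging (avgFun loopHol Idx)
open Literature.MathematicalPhysics.QuantumFieldTheory.Balaban1983to89.ExpMeanLog (expMeanLogSU)
open Literature.MathematicalPhysics.QuantumFieldTheory.Balaban1983to89.T3ContinuumYM3Torus (T3Family)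
open Literature.MathematicalPhysics.QuantumFieldTheory.Balaban1983to89.T3UnitScaleTilt (θBal)
open Literature.MathematicalPhysics.QuantumFieldTheory.Balaban1985CMP102 Literature.MathematicalPhysics.QuantumFieldTheory.Balaban1985CMP102.Setting
open Summit.QuantumFields.Balaban3D.Carriers
open Summit.QuantumFields.Balaban3D.Proofs.Primitives (AlphaConsts)
open Summit.QuantumFields.Balaban3D.Proofs.Thresholds (Q0 Q0_pos)
open Summit.QuantumFields.Balaban3D.Proofs.TowerAC Summit.QuantumFields.Balaban3D.Proofs.StandardAC Summit.QuantumFields.Balaban3D.Proofs.InputsAC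
open Summit.QuantumFields.Balaban3D.Proofs.Bound55Masses (chiB)
open Summit.QuantumFields.Balaban3D.Proofs.GaussianNormalization (partZ normalized)
open Summit.QuantumFields.YangMills.Theorems.PinnedStep (wtP Fibre55WinAC Fibre57LowOnAC)
open scoped NNReal ENNReal

/-! ## §1 The canonical chart radius `ε_P := (10·|Idx P|)⁻¹` -/

section Radius

variable (P : Params)

/-- `0 ≤ ε_P` for the canonical radius `ε_P := |Idx P|⁻¹/10`. [folklore] -/
theorem chartRadius_nonneg : 0 ≤ ((Fintype.card (Idx P) : ℝ))⁻¹ / 10 := by positivity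

/-- `ε_P ≤ 1/10` (`|Idx P| ≥ 1`: the index set `{0,…,L−1}^d × S_d × S_d` of (0.4) is inhabited). [cite: Balaban1987RG1, (0.4) p.253] -/
theorem chartRadius_le_tenth : ((Fintype.card (Idx P) : ℝ))⁻¹ / 10 ≤ 1 / 10 := by
  have h1 : (1 : ℝ) ≤ (Fintype.card (Idx P) : ℝ) := by exact_mod_cast Fintype.card_pos
  have : ((Fintype.card (Idx P) : ℝ))⁻¹ ≤ 1 := inv_le_one_of_one_le₀ h1
  linarith

/-- `10·ε_P ≤ |Idx P|⁻¹` (with equality) — the binder `hεI` of `BlockAvgEMLWeightedFibreChart.exists_weightedFibreChart(_global)`. [folklore] -/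
theorem ten_mul_chartRadius_le : 10 * (((Fintype.card (Idx P) : ℝ))⁻¹ / 10) ≤ ((Fintype.card (Idx P) : ℝ))⁻¹ :=
  le_of_eq (by ring)

/-- At the T³ record the canonical radius is `ε_P = (360·L³)⁻¹` (`|Idx (F.P K)| = L³·(3!)² = 36L³`, `BlockAvgCorrector.card_idx_T3`; `ε_P = emlWeight∕10`,
`BlockAvgCorrector.emlWeight_T3`). [cite: Balaban1987RG1, (0.4) p.253] -/
theorem chartRadius_T3_eq (F : T3Family) (K : ℕ) :
    ((Fintype.card (Idx (F.P K)) : ℝ))⁻¹ / 10 = (360 * (F.L : ℝ) ^ 3)⁻¹ := by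
  rw [BlockAvgCorrector.card_idx_T3]
  push_cast
  have hL : (0 : ℝ) < F.L := by exact_mod_cast (zero_lt_one.trans F.hL.2)
  field_simp
  ring

/-- **F2c's CHART AT THE RECORD WITH NO `ε`-HYPOTHESIS LEFT**: for the T³ family (`SU(2)`, `d = 3`) at every level `k + 1 ≤ m + K` there are measurable
`Φ`, `J ≥ 0`, `S` with the global fibre landing `Ū(Φ z) = z.1`, `Φ(S) ⊆ O_{ε_P}`, every `U ∈ O_{ε_P}` charted, and
`((((dV ⊗ dU′)↾S).withDensity J).map Φ = dU↾O_{ε_P}` at the canonical radius `ε_P = (10·|Idx (F.P K)|)⁻¹ = (360L³)⁻¹`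
(`BlockAvgEMLWeightedFibreChart.exists_weightedFibreChart_global` fed with §1's four radius facts and `eps_le_delta_two`). [cite: Balaban1985UV3, (13)–(18) pp.259–260] -/
theorem exists_weightedFibreChart_global_T3 (F : T3Family) (K k : ℕ) (hk : k + 1 ≤ F.m + K) :
    ∃ (Φ : GaugeField (F.P K) (k + 1) (Matrix.specialUnitaryGroup (Fin 2) ℂ) × GaugeField (F.P K) k (Matrix.specialUnitaryGroup (Fin 2) ℂ) →
          GaugeField (F.P K) k (Matrix.specialUnitaryGroup (Fin 2) ℂ))
      (J : GaugeField (F.P K) (k + 1) (Matrix.specialUnitaryGroup (Fin 2) ℂ) × GaugeField (F.P K) k (Matrix.specialUnitaryGroup (Fin 2) ℂ) → ℝ≥0)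
      (S : Set (GaugeField (F.P K) (k + 1) (Matrix.specialUnitaryGroup (Fin 2) ℂ) × GaugeField (F.P K) k (Matrix.specialUnitaryGroup (Fin 2) ℂ))),
      Measurable Φ ∧ Measurable J ∧ MeasurableSet S ∧
      (∀ z, avgFun expMeanLogSU (Φ z) = z.1) ∧
      (∀ z ∈ S, Φ z ∈ {U : GaugeField (F.P K) k (Matrix.specialUnitaryGroup (Fin 2) ℂ) |
        ∀ c i, dist1 (loopHol U c i) < ((Fintype.card (Idx (F.P K)) : ℝ))⁻¹ / 10}) ∧
      (∀ U ∈ {U : GaugeField (F.P K) k (Matrix.specialUnitaryGroup (Fin 2) ℂ) |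
          ∀ c i, dist1 (loopHol U c i) < ((Fintype.card (Idx (F.P K)) : ℝ))⁻¹ / 10},
        (avgFun expMeanLogSU U, U) ∈ S ∧ Φ (avgFun expMeanLogSU U, U) = U) ∧
      ((((fieldMeasure (F.P K) (k + 1) (Matrix.specialUnitaryGroup (Fin 2) ℂ)).prod
            (fieldMeasure (F.P K) k (Matrix.specialUnitaryGroup (Fin 2) ℂ))).restrict S).withDensity (fun z => (J z : ℝ≥0∞))).map Φ =
        (fieldMeasure (F.P K) k (Matrix.specialUnitaryGroup (Fin 2) ℂ)).restrict
          {U : GaugeField (F.P K) k (Matrix.specialUnitaryGroup (Fin 2) ℂ) |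
            ∀ c i, dist1 (loopHol U c i) < ((Fintype.card (Idx (F.P K)) : ℝ))⁻¹ / 10} :=
  BlockAvgEMLWeightedFibreChart.exists_weightedFibreChart_global (P := F.P K) (N := 2) hk (chartRadius_nonneg (F.P K))
    (chartRadius_le_tenth (F.P K)) (ten_mul_chartRadius_le (F.P K)) (eps_le_delta_two (chartRadius_le_tenth (F.P K)))

end Radius

/-! ## §2 The size line at the T³ scales on a coupling window ∕ from one `γ₀`-row -/

section SizeLine

variable {F : T3Family} {𝔠 : AlphaConsts F.L (suGroupModel 2).N}

/-- `ε₁(j) = g_j p(g_j) = θBal L γ b₀ p₀ (K − j)` for `j ≤ K` at the T³ scales `T3Scales F γ … K` of ANY coupling `0 < γ ≤ 1` with the record's carrier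
constants — the window-free form of `AlphaInputsT3AC.eps1Of_T3Scales_eq` (same three-line proof, `T3Scales_gk_eq`). [cite: Balaban1985UV3, (3) p.256 and (7) p.257] -/
theorem eps1Of_T3Scales_eq_of_le_one (γ : ℝ) (hγ : 0 < γ) (hγ1 : γ ≤ 1) (K j : ℕ) (hj : j ≤ K) :
    eps1Of (T3Scales F γ hγ hγ1 K) 𝔠.lane.carrier j = θBal F.L γ 𝔠.b₀ 𝔠.p₀ (K - j) := by
  show (T3Scales F γ hγ hγ1 K).gk j * B10.pFun 𝔠.b₀ 𝔠.p₀ ((T3Scales F γ hγ hγ1 K).gk j) = _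
  rw [T3Scales_gk_eq F γ hγ hγ1 K j hj]
  rfl

/-- **`B·ε₁(k) < ε` AT EVERY `(K, k ≤ K)` ON A COUPLING WINDOW — GENERIC IN THE TARGET** (`B, ε > 0`): for `0 < γ ≤ 1` with
`γ ≤ (((ε/(2B))/(b₀Q₀(p₀)))²)²`, `θBal ≤ ε/(2B)` at every distance (`T3Thresholds.θBal_le_of_le_gamma`, `Q₀(p₀) = (2p₀)^{p₀}e^{½−p₀}`) and
`ε₁(k) = θBal(K − k)`, so `B·ε₁(k) ≤ ε/2 < ε`; positivity is `PinnedStep.eps1Of_carrier_pos`.  This is the currency of the crux's prefix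
«`∃ γ₁, ∀ γ ≤ γ₁`» (stmt 20520); a B0 definer choosing a chart radius below `ε_P`, or another loop-length constant, re-uses this form. [cite: Balaban1985UV3, (7) p.257] -/
theorem eps1Of_T3_mul_lt_of_le_gamma {B ε : ℝ} (hB : 0 < B) (hε : 0 < ε) (γ : ℝ) (hγ : 0 < γ) (hγ1 : γ ≤ 1)
    (hγs : γ ≤ (((ε / (2 * B)) / (𝔠.b₀ * Q0 𝔠.p₀)) ^ 2) ^ 2) (K k : ℕ) (hk : k ≤ K) :
    0 < eps1Of (T3Scales F γ hγ hγ1 K) 𝔠.lane.carrier k ∧ B * eps1Of (T3Scales F γ hγ hγ1 K) 𝔠.lane.carrier k < ε := by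
  have hL1 : 1 ≤ F.L := le_of_lt F.hL.2
  have hσ : 0 ≤ ε / (2 * B) := by positivity
  refine ⟨PinnedStep.eps1Of_carrier_pos (S := T3Scales F γ hγ hγ1 K) 𝔠.lane k hk, ?_⟩
  have heps : eps1Of (T3Scales F γ hγ hγ1 K) 𝔠.lane.carrier k ≤ ε / (2 * B) := by
    rw [eps1Of_T3Scales_eq_of_le_one (𝔠 := 𝔠) γ hγ hγ1 K k hk]
    exact T3Thresholds.θBal_le_of_le_gamma hL1 𝔠.b₀_pos 𝔠.p₀_pos hσ hγ hγ1 hγs (K - k)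
  calc B * eps1Of (T3Scales F γ hγ hγ1 K) 𝔠.lane.carrier k ≤ B * (ε / (2 * B)) := mul_le_mul_of_nonneg_left heps hB.le
    _ = ε / 2 := by field_simp
    _ < ε := by linarith

/-- **THE SAME FROM ONE `γ₀`-ROW, ON THE RECORD'S WINDOW `γ ≤ (min γ₀ 1)²`**: `γ₀ ≤ (((ε/(2B))/(b₀Q₀(p₀)))²)²` ⟹ `0 < ε₁(k) ∧ B·ε₁(k) < ε` at every
`(γ, K, k ≤ K)` of the window (every window coupling is `≤ γ₀`, `MinimiserPin.le_gamma0_of_window`) — the currency of the record rows on `γ₀`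
(`AlphaInputsT3ACv4SeamWindow`). [cite: Balaban1985UV3, (7) p.257] -/
theorem eps1Of_T3_mul_lt_of_gamma0 {B ε : ℝ} (hB : 0 < B) (hε : 0 < ε)
    (hg : 𝔠.gamma0 ≤ (((ε / (2 * B)) / (𝔠.b₀ * Q0 𝔠.p₀)) ^ 2) ^ 2)
    (γ : ℝ) (hγ : 0 < γ) (hγ1 : γ ≤ (min 𝔠.gamma0 1) ^ 2) (K k : ℕ) (hk : k ≤ K) :
    0 < eps1Of (T3Scales F γ hγ (hγ1.trans (sq_min_one_le _ 𝔠.gamma0_pos)) K) 𝔠.lane.carrier k ∧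
      B * eps1Of (T3Scales F γ hγ (hγ1.trans (sq_min_one_le _ 𝔠.gamma0_pos)) K) 𝔠.lane.carrier k < ε :=
  eps1Of_T3_mul_lt_of_le_gamma hB hε γ hγ _ ((MinimiserPin.le_gamma0_of_window 𝔠 hγ1).trans hg) K k hk

/-- `(360L³)⁻¹/(2·(25L²/4)) = (4500·L⁵)⁻¹`: today's size threshold. [folklore] -/
theorem sizeThreshold_T3_eq (F : T3Family) :
    (360 * (F.L : ℝ) ^ 3)⁻¹ / (2 * (25 * (F.L : ℝ) ^ 2 / 4)) = ((4500 : ℝ) * (F.L : ℝ) ^ 5)⁻¹ := by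
  have hL : (0 : ℝ) < F.L := by exact_mod_cast (zero_lt_one.trans F.hL.2)
  field_simp
  ring

/-- **THE SIZE LINE OF THE RECORD KNIT ON A COUPLING WINDOW** (today's numbers): for `0 < γ ≤ 1` with `γ ≤ (((4500·L⁵)⁻¹/(b₀Q₀(p₀)))²)²`, every run
`K` and every level `k ≤ K`: `0 ≤ ε₁(k)` and `((d+2)L)²ε₁(k)/4 < ε_P = (10·|Idx (F.P K)|)⁻¹` — the binders `hεS`, `hwin` of
`fibre55WinAC_triv_of_blockAvgChart` ∕ `fibre57LowOnAC_of_blockAvgChart` at `S := T3Scales F γ … K` (`(25L²/4)·(4500L⁵)⁻¹ = (360L³)⁻¹/2`).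
[cite: Balaban1985UV3, (7) p.257 + (49) p.268] -/
theorem sizeLine_T3_of_le_gamma (γ : ℝ) (hγ : 0 < γ) (hγ1 : γ ≤ 1)
    (hγs : γ ≤ ((((4500 : ℝ) * (F.L : ℝ) ^ 5)⁻¹ / (𝔠.b₀ * Q0 𝔠.p₀)) ^ 2) ^ 2) (K k : ℕ) (hk : k ≤ K) :
    0 ≤ eps1Of (T3Scales F γ hγ hγ1 K) 𝔠.lane.carrier k ∧
      ((((F.P K).d + 2) * (F.P K).L : ℕ) : ℝ) ^ 2 / 4 * eps1Of (T3Scales F γ hγ hγ1 K) 𝔠.lane.carrier k <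
        ((Fintype.card (Idx (F.P K)) : ℝ))⁻¹ / 10 := by
  have hL : (0 : ℝ) < F.L := by exact_mod_cast (zero_lt_one.trans F.hL.2)
  -- `((d+2)L)²/4 = 25L²/4` at `d = 3` is `BlockAvgCorrector.stokesConst_T3` (`stokesConst` unfolds to the displayed constant)
  rw [show ((((F.P K).d + 2) * (F.P K).L : ℕ) : ℝ) ^ 2 / 4 = 25 * (F.L : ℝ) ^ 2 / 4 from BlockAvgCorrector.stokesConst_T3 F K,
    chartRadius_T3_eq]
  have hB : (0 : ℝ) < 25 * (F.L : ℝ) ^ 2 / 4 := by positivity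
  have hε : (0 : ℝ) < (360 * (F.L : ℝ) ^ 3)⁻¹ := by positivity
  have hγs' : γ ≤ (((((360 * (F.L : ℝ) ^ 3)⁻¹ / (2 * (25 * (F.L : ℝ) ^ 2 / 4))) / (𝔠.b₀ * Q0 𝔠.p₀)) ^ 2) ^ 2) := by
    rw [sizeThreshold_T3_eq]; exact hγs
  obtain ⟨hpos, hlt⟩ := eps1Of_T3_mul_lt_of_le_gamma hB hε γ hγ hγ1 hγs' K k hk
  exact ⟨hpos.le, hlt⟩

/-- **THE SIZE LINE OF THE RECORD KNIT FROM ONE `γ₀`-ROW** (today's numbers): `γ₀ ≤ (((4500·L⁵)⁻¹/(b₀Q₀(p₀)))²)²` ⟹ at every coupling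
`0 < γ ≤ (min γ₀ 1)²`, every run `K` and every level `k ≤ K`: `0 ≤ ε₁(k)` and `((d+2)L)²ε₁(k)/4 < ε_P`. [cite: Balaban1985UV3, (7) p.257 + (49) p.268] -/
theorem sizeLine_T3_of_gamma0 (hg : 𝔠.gamma0 ≤ ((((4500 : ℝ) * (F.L : ℝ) ^ 5)⁻¹ / (𝔠.b₀ * Q0 𝔠.p₀)) ^ 2) ^ 2)
    (γ : ℝ) (hγ : 0 < γ) (hγ1 : γ ≤ (min 𝔠.gamma0 1) ^ 2) (K k : ℕ) (hk : k ≤ K) :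
    0 ≤ eps1Of (T3Scales F γ hγ (hγ1.trans (sq_min_one_le _ 𝔠.gamma0_pos)) K) 𝔠.lane.carrier k ∧
      ((((F.P K).d + 2) * (F.P K).L : ℕ) : ℝ) ^ 2 / 4 * eps1Of (T3Scales F γ hγ (hγ1.trans (sq_min_one_le _ 𝔠.gamma0_pos)) K) 𝔠.lane.carrier k <
        ((Fintype.card (Idx (F.P K)) : ℝ))⁻¹ / 10 :=
  sizeLine_T3_of_le_gamma γ hγ _ ((MinimiserPin.le_gamma0_of_window 𝔠 hγ1).trans hg) K k hk

end SizeLine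

/-! ## §3 The two record-knit rows at the T³ record with the size line discharged -/

section Record

variable {F : T3Family} (𝔠 : AlphaConsts F.L (suGroupModel 2).N) {γ : ℝ} {hγ : 0 < γ} {hγ1' : γ ≤ 1} {K : ℕ}
  {Val : Type} [NormedAddCommGroup Val] [NormedSpace ℂ Val]
  (X : ExternalInputsAC (T3Scales F γ hγ hγ1' K) (Matrix.specialUnitaryGroup (Fin 2) ℂ))
  (𝔖 : ∀ k, StepSeries (T3Scales F γ hγ hγ1' K) (Matrix.specialUnitaryGroup (Fin 2) ℂ) Val
    (nblkOf (T3Scales F γ hγ hγ1' K) 𝔠.lane.carrier k) k)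

/-- ★★ **THE UPPER ROW `Fibre55WinAC` AT THE TRIVIAL NEW HISTORY, AT THE T³ RECORD, SIZE LINE DISCHARGED.**  Lane constants `𝔠.lane`, scales
`T3Scales F γ … K` at a coupling `0 < γ ≤ 1` inside the SIZE WINDOW `γ ≤ (((4500·L⁵)⁻¹/(b₀Q₀(p₀)))²)²` (on the record's window `γ ≤ (min γ₀ 1)²` this is
the `γ₀`-row of `sizeLine_T3_of_gamma0` via `MinimiserPin.le_gamma0_of_window`), `SU(2)`, an AC tower `X` averaging at level `k` by `avgFun ℰp` (`hav`;
holds for `XT3`, `avg_XT3_eq_avgFun`), run level `k + 1 ≤ K` (so `k + 1 ≤ m + K`); chart radius `ε := ε_P = (10·|Idx (F.P K)|)⁻¹` (at which F2c's chart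
EXISTS outright, `exists_weightedFibreChart_global_T3`).  Given the chart binders `(Φ, J, T)` with `hΦ hJ hT hmap hfib`, the displayed data rows and the
(55) PINS of `𝔖` at `triv′` written against `(fieldMeasure, q, e^{−(ℓσ+d_g log g_k)N}·𝟙_T·J, Φ)`: `Fibre55WinAC 𝔠.lane X 𝔖 win k (Hist.triv _ (k+1))` —
`fibre55WinAC_triv_of_blockAvgChart` with `hεS`∕`hwin := sizeLine_T3_of_le_gamma`. [cite: Balaban1985UV3, (13)–(18) pp.259–260 + (49)–(55) pp.268–269 + (58) p.270] -/
theorem fibre55WinAC_triv_T3_of_le_gamma (hγs : γ ≤ ((((4500 : ℝ) * (F.L : ℝ) ^ 5)⁻¹ / (𝔠.b₀ * Q0 𝔠.p₀)) ^ 2) ^ 2)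
    (win : (k : ℕ) → Hist (F.P K) (k + 1) → Set (GaugeField (F.P K) (k + 1) (Matrix.specialUnitaryGroup (Fin 2) ℂ))) (k : ℕ) (hk : k + 1 ≤ K)
    (hav : (X.av k).avg = avgFun (expMeanLogSU (n := Fin 2)))
    (Φ : GaugeField (F.P K) (k + 1) (Matrix.specialUnitaryGroup (Fin 2) ℂ) × GaugeField (F.P K) k (Matrix.specialUnitaryGroup (Fin 2) ℂ) →
      GaugeField (F.P K) k (Matrix.specialUnitaryGroup (Fin 2) ℂ))
    (J : GaugeField (F.P K) (k + 1) (Matrix.specialUnitaryGroup (Fin 2) ℂ) × GaugeField (F.P K) k (Matrix.specialUnitaryGroup (Fin 2) ℂ) → ℝ≥0)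
    (T : Set (GaugeField (F.P K) (k + 1) (Matrix.specialUnitaryGroup (Fin 2) ℂ) × GaugeField (F.P K) k (Matrix.specialUnitaryGroup (Fin 2) ℂ)))
    (hΦ : Measurable Φ) (hJ : Measurable J) (hT : MeasurableSet T)
    (hmap : ((((fieldMeasure (F.P K) (k + 1) (Matrix.specialUnitaryGroup (Fin 2) ℂ)).prod
        (fieldMeasure (F.P K) k (Matrix.specialUnitaryGroup (Fin 2) ℂ))).restrict T).withDensity (fun z => (J z : ℝ≥0∞))).map Φ =
      (fieldMeasure (F.P K) k (Matrix.specialUnitaryGroup (Fin 2) ℂ)).restrict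
        {U : GaugeField (F.P K) k (Matrix.specialUnitaryGroup (Fin 2) ℂ) |
          ∀ c i, dist1 (loopHol U c i) < ((Fintype.card (Idx (F.P K)) : ℝ))⁻¹ / 10})
    (hfib : ∀ z, avgFun (expMeanLogSU (n := Fin 2)) (Φ z) = z.1) (N lσ dg : ℝ)
    (q : GaugeField (F.P K) (k + 1) (Matrix.specialUnitaryGroup (Fin 2) ℂ) → GaugeField (F.P K) k (Matrix.specialUnitaryGroup (Fin 2) ℂ) → ℝ)
    (hqm : ∀ V, Measurable (q V)) (hZ : ∀ V, 0 < partZ (fieldMeasure (F.P K) k (Matrix.specialUnitaryGroup (Fin 2) ℂ)) (q V))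
    (hU : Measurable (X.UkH k (Hist.triv (F.P K) k))) (hPm : Measurable ((inputOfAC 𝔠.lane X 𝔖).Pint k (Hist.triv (F.P K) k)))
    (cP : ℝ) (hPb : ∀ U, (inputOfAC 𝔠.lane X 𝔖).Pint k (Hist.triv (F.P K) k) U ≤ cP)
    (hinv : GaugeInvariant (fun U : GaugeField (F.P K) k (Matrix.specialUnitaryGroup (Fin 2) ℂ) =>
      Real.exp (-((towerOfAC 𝔠.lane X 𝔖).mainT k (Hist.triv (F.P K) k) U) + (towerOfAC 𝔠.lane X 𝔖).Pint k (Hist.triv (F.P K) k) U)))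
    (hwt : ∀ U : GaugeField (F.P K) k (Matrix.specialUnitaryGroup (Fin 2) ℂ),
      chiB 𝔠.lane.carrier.M₁ (rcolOf (T3Scales F γ hγ hγ1' K) 𝔠.lane.carrier) (eps1Of (T3Scales F γ hγ hγ1' K) 𝔠.lane.carrier) k
        (Hist.triv (F.P K) (k + 1)) U ≠ 0 → wtP 𝔠.lane X win k (Hist.triv (F.P K) k) U = 1)
    (hsmall : ∀ U : GaugeField (F.P K) k (Matrix.specialUnitaryGroup (Fin 2) ℂ),
      chiB 𝔠.lane.carrier.M₁ (rcolOf (T3Scales F γ hγ hγ1' K) 𝔠.lane.carrier) (eps1Of (T3Scales F γ hγ hγ1' K) 𝔠.lane.carrier) k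
        (Hist.triv (F.P K) (k + 1)) U ≠ 0 → (X.av k).avg U ∈ win k (Hist.triv (F.P K) (k + 1)))
    (hσ : (piecesAC 𝔠.lane X 𝔖 k).logσ₀ = lσ) (hdg : (piecesAC 𝔠.lane X 𝔖 k).dg = dg)
    (hstar : (piecesAC 𝔠.lane X 𝔖 k).starB (Hist.triv (F.P K) (k + 1)) = N)
    (hZU : ∀ V, (piecesAC 𝔠.lane X 𝔖 k).logZU (Hist.triv (F.P K) (k + 1)) V =
      Real.log (partZ (fieldMeasure (F.P K) k (Matrix.specialUnitaryGroup (Fin 2) ℂ)) (q V)))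
    (hFl : ∀ V, (piecesAC 𝔠.lane X 𝔖 k).logFl (Hist.triv (F.P K) (k + 1)) V =
      Real.log (∫ U', (Real.exp (-((lσ + dg * Real.log ((T3Scales F γ hγ hγ1' K).gk k)) * N)) * T.indicator (fun z => (J z : ℝ)) (V, U')) *
              chiB 𝔠.lane.carrier.M₁ (rcolOf (T3Scales F γ hγ hγ1' K) 𝔠.lane.carrier) (eps1Of (T3Scales F γ hγ hγ1' K) 𝔠.lane.carrier) k
                (Hist.triv (F.P K) (k + 1)) (Φ (V, U')) *
              Real.exp (-((towerOfAC 𝔠.lane X 𝔖).mainT k (Hist.triv (F.P K) k) (Φ (V, U')) -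
                    (towerOfAC 𝔠.lane X 𝔖).mainT (k + 1) (Hist.triv (F.P K) (k + 1)) V)
                + ((towerOfAC 𝔠.lane X 𝔖).Pint k (Hist.triv (F.P K) k) (Φ (V, U')) - (piecesAC 𝔠.lane X 𝔖 k).Pold (Hist.triv (F.P K) (k + 1)) V)
                + q V U')
            ∂(normalized (fieldMeasure (F.P K) k (Matrix.specialUnitaryGroup (Fin 2) ℂ)) (q V)))) :
    Fibre55WinAC 𝔠.lane X 𝔖 win k (Hist.triv (F.P K) (k + 1)) := by
  have hsize := sizeLine_T3_of_le_gamma (𝔠 := 𝔠) γ hγ hγ1' hγs K k (by omega)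
  have hk' : k + 1 ≤ (T3Scales F γ hγ hγ1' K).P.m + (T3Scales F γ hγ hγ1' K).P.K := by show k + 1 ≤ F.m + K; omega
  exact fibre55WinAC_triv_of_blockAvgChart 𝔠.lane X 𝔖 win k hk' hav hsize.1 hsize.2 Φ J T hΦ hJ hT hmap hfib N lσ dg q hqm hZ hU hPm cP hPb
    hinv hwt hsmall hσ hdg hstar hZU hFl

/-- ★★ **THE LOWER ROW `Fibre57LowOnAC` AT THE T³ RECORD, SIZE LINE DISCHARGED** — the same substitution in `fibre57LowOnAC_of_blockAvgChart`:
size window on `γ` + chart binders (`hfib` on `T` only) + displayed rows `hlom hloinv hdom` + pins (+ `hpos`) ⟹ `Fibre57LowOnAC 𝔠.lane X 𝔖 lo k`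
(level `k ≤ K` of the run). [cite: Balaban1985UV3, (37) p.265 + (47) p.267 + (55)–(58) pp.269–270 + p.272 L32–33] -/
theorem fibre57LowOnAC_T3_of_le_gamma (hγs : γ ≤ ((((4500 : ℝ) * (F.L : ℝ) ^ 5)⁻¹ / (𝔠.b₀ * Q0 𝔠.p₀)) ^ 2) ^ 2)
    (lo : (k : ℕ) → Set (GaugeField (F.P K) k (Matrix.specialUnitaryGroup (Fin 2) ℂ))) (k : ℕ) (hk : k ≤ K)
    (hav : (X.av k).avg = avgFun (expMeanLogSU (n := Fin 2)))
    (Φ : GaugeField (F.P K) (k + 1) (Matrix.specialUnitaryGroup (Fin 2) ℂ) × GaugeField (F.P K) k (Matrix.specialUnitaryGroup (Fin 2) ℂ) →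
      GaugeField (F.P K) k (Matrix.specialUnitaryGroup (Fin 2) ℂ))
    (J : GaugeField (F.P K) (k + 1) (Matrix.specialUnitaryGroup (Fin 2) ℂ) × GaugeField (F.P K) k (Matrix.specialUnitaryGroup (Fin 2) ℂ) → ℝ≥0)
    (T : Set (GaugeField (F.P K) (k + 1) (Matrix.specialUnitaryGroup (Fin 2) ℂ) × GaugeField (F.P K) k (Matrix.specialUnitaryGroup (Fin 2) ℂ)))
    (hΦ : Measurable Φ) (hJ : Measurable J) (hT : MeasurableSet T)
    (hmap : ((((fieldMeasure (F.P K) (k + 1) (Matrix.specialUnitaryGroup (Fin 2) ℂ)).prod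
        (fieldMeasure (F.P K) k (Matrix.specialUnitaryGroup (Fin 2) ℂ))).restrict T).withDensity (fun z => (J z : ℝ≥0∞))).map Φ =
      (fieldMeasure (F.P K) k (Matrix.specialUnitaryGroup (Fin 2) ℂ)).restrict
        {U : GaugeField (F.P K) k (Matrix.specialUnitaryGroup (Fin 2) ℂ) |
          ∀ c i, dist1 (loopHol U c i) < ((Fintype.card (Idx (F.P K)) : ℝ))⁻¹ / 10})
    (hfib : ∀ z ∈ T, avgFun (expMeanLogSU (n := Fin 2)) (Φ z) = z.1) (N lσ dg : ℝ)
    (q : GaugeField (F.P K) (k + 1) (Matrix.specialUnitaryGroup (Fin 2) ℂ) → GaugeField (F.P K) k (Matrix.specialUnitaryGroup (Fin 2) ℂ) → ℝ)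
    (hqm : ∀ V, Measurable (q V)) (hZ : ∀ V, 0 < partZ (fieldMeasure (F.P K) k (Matrix.specialUnitaryGroup (Fin 2) ℂ)) (q V))
    (hU : Measurable (X.UkH k (Hist.triv (F.P K) k))) (hPm : Measurable ((inputOfAC 𝔠.lane X 𝔖).Pint k (Hist.triv (F.P K) k)))
    (cP : ℝ) (hPb : ∀ U, (inputOfAC 𝔠.lane X 𝔖).Pint k (Hist.triv (F.P K) k) U ≤ cP)
    (hinv : GaugeInvariant (fun U : GaugeField (F.P K) k (Matrix.specialUnitaryGroup (Fin 2) ℂ) =>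
      Real.exp (-((towerOfAC 𝔠.lane X 𝔖).mainT k (Hist.triv (F.P K) k) U) + (towerOfAC 𝔠.lane X 𝔖).Pint k (Hist.triv (F.P K) k) U)))
    (hlom : MeasurableSet (lo k))
    (hloinv : ∀ (u : GaugeTransf (F.P K) k (Matrix.specialUnitaryGroup (Fin 2) ℂ)) (U : GaugeField (F.P K) k (Matrix.specialUnitaryGroup (Fin 2) ℂ)),
      gaugeAct u U ∈ lo k ↔ U ∈ lo k)
    (hdom : ∀ U : GaugeField (F.P K) k (Matrix.specialUnitaryGroup (Fin 2) ℂ),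
      chiB 𝔠.lane.carrier.M₁ (rcolOf (T3Scales F γ hγ hγ1' K) 𝔠.lane.carrier) (eps1Of (T3Scales F γ hγ hγ1' K) 𝔠.lane.carrier) k
        (Hist.triv (F.P K) (k + 1)) U ≠ 0 → U ∈ lo k)
    (hσ : (piecesAC 𝔠.lane X 𝔖 k).logσ₀ = lσ) (hdg : (piecesAC 𝔠.lane X 𝔖 k).dg = dg)
    (hstar : (piecesAC 𝔠.lane X 𝔖 k).starB (Hist.triv (F.P K) (k + 1)) = N)
    (hZU : ∀ V, (piecesAC 𝔠.lane X 𝔖 k).logZU (Hist.triv (F.P K) (k + 1)) V =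
      Real.log (partZ (fieldMeasure (F.P K) k (Matrix.specialUnitaryGroup (Fin 2) ℂ)) (q V)))
    (hFl : ∀ V, (piecesAC 𝔠.lane X 𝔖 k).logFl (Hist.triv (F.P K) (k + 1)) V =
      Real.log (∫ U', (Real.exp (-((lσ + dg * Real.log ((T3Scales F γ hγ hγ1' K).gk k)) * N)) * T.indicator (fun z => (J z : ℝ)) (V, U')) *
              chiB 𝔠.lane.carrier.M₁ (rcolOf (T3Scales F γ hγ hγ1' K) 𝔠.lane.carrier) (eps1Of (T3Scales F γ hγ hγ1' K) 𝔠.lane.carrier) k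
                (Hist.triv (F.P K) (k + 1)) (Φ (V, U')) *
              Real.exp (-((towerOfAC 𝔠.lane X 𝔖).mainT k (Hist.triv (F.P K) k) (Φ (V, U')) -
                    (towerOfAC 𝔠.lane X 𝔖).mainT (k + 1) (Hist.triv (F.P K) (k + 1)) V)
                + ((towerOfAC 𝔠.lane X 𝔖).Pint k (Hist.triv (F.P K) k) (Φ (V, U')) - (piecesAC 𝔠.lane X 𝔖 k).Pold (Hist.triv (F.P K) (k + 1)) V)
                + q V U')
            ∂(normalized (fieldMeasure (F.P K) k (Matrix.specialUnitaryGroup (Fin 2) ℂ)) (q V))))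
    (hpos : ∀ V, V ∈ lo (k + 1) →
      0 < ∫ U', (Real.exp (-((lσ + dg * Real.log ((T3Scales F γ hγ hγ1' K).gk k)) * N)) * T.indicator (fun z => (J z : ℝ)) (V, U')) *
              chiB 𝔠.lane.carrier.M₁ (rcolOf (T3Scales F γ hγ hγ1' K) 𝔠.lane.carrier) (eps1Of (T3Scales F γ hγ hγ1' K) 𝔠.lane.carrier) k
                (Hist.triv (F.P K) (k + 1)) (Φ (V, U')) *
              Real.exp (-((towerOfAC 𝔠.lane X 𝔖).mainT k (Hist.triv (F.P K) k) (Φ (V, U')) -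
                    (towerOfAC 𝔠.lane X 𝔖).mainT (k + 1) (Hist.triv (F.P K) (k + 1)) V)
                + ((towerOfAC 𝔠.lane X 𝔖).Pint k (Hist.triv (F.P K) k) (Φ (V, U')) - (piecesAC 𝔠.lane X 𝔖 k).Pold (Hist.triv (F.P K) (k + 1)) V)
                + q V U')
            ∂(normalized (fieldMeasure (F.P K) k (Matrix.specialUnitaryGroup (Fin 2) ℂ)) (q V))) :
    Fibre57LowOnAC 𝔠.lane X 𝔖 lo k := by
  have hsize := sizeLine_T3_of_le_gamma (𝔠 := 𝔠) γ hγ hγ1' hγs K k hk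
  exact fibre57LowOnAC_of_blockAvgChart 𝔠.lane X 𝔖 lo k hav hsize.1 hsize.2 Φ J T hΦ hJ hT hmap hfib N lσ dg q hqm hZ hU hPm cP hPb hinv
    hlom hloinv hdom hσ hdg hstar hZU hFl hpos

end Record

end Summit.QuantumFields.YangMills.Theorems.PinnedStepTrivPins

end
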